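import Mathlib
import HarnessLib
import Summits.NavierStokesRegularity.NavierStokesRegularity.Theorems.HalfSpaceWindowDoorCirculationCarryingRigidityConeFluxSubsolution
import Summits.NavierStokesRegularity.NavierStokesRegularity.Theorems.HalfSpaceWindowDoorCirculationCarryingRigidityWholeSpaceMaxPrinciple
import Summits.NavierStokesRegularity.NavierStokesRegularity.Theorems.HalfSpaceWindowDoorCirculationCarryingRigidityAngularMeanDrift
import Literature.Analysis.FluidPDE.MeridianReduction
import Summits.NavierStokesRegularity.NavierStokesRegularity.Theorems.HalfSpaceWindowDoorCirculationCarryingRigidityEddyMeans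

/-!
# Route `HalfSpaceWindowDoor`, crux `CirculationCarryingRigidity` (stmt-NavierStokesRegularity-25311) —
# line `eddy_covariance`, Step 2 (barrier): the comparison `Γ ≤ μ + A|x_h|²/√(s s₀)` from the EDDY bound on record far circles

LEAD ns-hsw-p1 g10, `--supports stmt-NavierStokesRegularity-25311 --as helper`; card `Cruxes/…/Lines/eddy_covariance.md`.
SYNTHESIS of g4's remainder form of the circle law (`…AngularMeanDrift.deriv_circ_s_eq_remainder`:
`∂ₛΓ = Γ_rr − r⁻¹Γ_r + Γ_zz + ℛ − v̄_r ∮ω₃ dl + v̄_z ∮ω_r dl`, `ℛ = ∮[(v_z − v̄_z) ω_r − (v_r − v̄_r) ω₃] dl` the fluctuation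
(eddy) remainder) with g9's record barrier (`…RecordSweeping.circ_le_of_record_aux`, time-only class).  The whole-space maximum
principle `…WholeSpaceMaxPrinciple.le_of_subsolution` accepts ANY bounded drift, so the MEAN ADVECTION — radial `v̄_r Γ_r` AND
vertical `v̄_z Γ_z`, `|v̄_r|, |v̄_z| ≤ C/√(−t)` (`…EddyMeans`) — rides in the drift
`b = (2/r − B/√(−t) + v̄_r) e_r + (v̄_z + β) e_z` (the barrier `φ = μ + A|x_h|²/√(s s₀)` is `z`-independent, and radially it beats
any inward speed `≤ (B + C)/√(−t)` outside the tube `r ≤ 4(B+C)√(−t)`), while the sign multiplier `β = ±B/√(−t)` absorbs any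
term `≤ (B/√(−t))|Γ_z| = (B/√(−t))|∮ω_r dl|`.  RESULT `circ_le_of_eddy_aux`: `Γ(r,z,s) ≤ μ + π(4K₁+1) r²/(√(−s)√(−s₀))` on
`[s₀,s₁]`, `μ = sup{Γ(R₁√(−s'),z',s') : s' ≤ s₁}`, `R₁ = 4(B+C) + R₀ + 1`, from the EDDY BOUND
`ℛ(r,z,t) ≤ (B/√(−t))·(∮_{S(r,z)} ω₃ dl + |∮_{S(r,z)} ω_r dl|)` at times `t ≤ s₁` on RECORD far circles only.
Sweeping conclusions in `…EddySweeping`; W6 ⟸ the eddy bound in `…EddyLiouville`.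
WHAT THIS IS NOT: not about NS regularity; HYPOTHETICAL blow-up profiles (KNSS ancient mild solutions).  No item is closed here.
-/

noncomputable section

-- the summit and its single sub-problem share the name (CONVENTIONS §1), as in every Theorems file
set_option linter.dupNamespace false

namespace Summit.NavierStokesRegularity.NavierStokesRegularity.Theorems.HalfSpaceWindowDoorCirculationCarryingRigidityEddyBarrier

open MeasureTheory Set Function Filter Topology InnerProductSpace
open scoped RealInnerProductSpace InnerProductSpace Laplacian
open Literature.Analysis Literature.Analysis.UnboundedOperators
open Literature.Analysis.FluidPDE hiding eR
open Summit.NavierStokesRegularity.NavierStokesRegularity.Theorems.HalfSpaceWindowDoorCirculationCarryingRigidityDefs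
  (InDoorClass SignE3 e3)
open Summit.NavierStokesRegularity.NavierStokesRegularity.Theorems.AxisTwistDoorAveragedConeLiouvilleDefs
  (cylPt eT eR circ vortCirc radVortCirc tiltCirc circleTerm meanR meanZ remainder)
open Summit.NavierStokesRegularity.NavierStokesRegularity.Theorems.AveragedConeLiouville.CircleStokes
  (deriv_circ_eq_vortCirc)
open Summit.NavierStokesRegularity.NavierStokesRegularity.Theorems.AveragedConeLiouville.CircleCalculus (deriv_circ_z)
open Summit.NavierStokesRegularity.NavierStokesRegularity.Theorems.AveragedConeLiouville.CircMonotone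
  (circ_zero circ_mono circ_nonneg vortCirc_nonneg)
open Summit.NavierStokesRegularity.NavierStokesRegularity.Theorems.HalfSpaceWindowDoorCirculationCarryingRigidityAxisCirculation
  (contDiff_circF isSmoothSpaceTimeOn_circF isSmoothSpaceTimeOn_of_class fderiv_circF_eR laplacian_circF hasDerivAt_circF_time
    contDiffOn_circ)
open Summit.NavierStokesRegularity.NavierStokesRegularity.Theorems.HalfSpaceWindowDoorCirculationCarryingRigidityAngularMeanDrift
  (deriv_circ_s_eq_remainder)
open Summit.NavierStokesRegularity.NavierStokesRegularity.Theorems.HalfSpaceWindowDoorCirculationCarryingRigidityWholeSpaceMaxPrinciple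
  (le_of_subsolution)
open Summit.NavierStokesRegularity.NavierStokesRegularity.Theorems.PoloidalWindowDoorPoloidalWindowRigidityClassSpaceTimeRates
  (exists_fderiv_rate_of_class')

open Summit.NavierStokesRegularity.NavierStokesRegularity.Theorems.HalfSpaceWindowDoorCirculationCarryingRigidityConeFluxSubsolution
variable {C : ℝ} {v : ℝ → EuclideanSpace ℝ (Fin 3) → EuclideanSpace ℝ (Fin 3)}

open Summit.NavierStokesRegularity.NavierStokesRegularity.Theorems.HalfSpaceWindowDoorCirculationCarryingRigidityEddyMeans
  (abs_meanR_le abs_meanZ_le fderiv_circF_eZ barrier_upper_bound)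

set_option maxHeartbeats 800000 in
/-- **Step 2 with the barrier** (eddy form): `Γ(r,z,s) ≤ μ + A r²/(√(−s)√(−s₀))` on `[s₀,s₁]`, `μ = sup{Γ(R₁√(−s'),z',s') : s' ≤ s₁}`,
`R₁ = 4(B+C) + R₀ + 1`, from the EDDY bound `ℛ ≤ (B/√(−t))(∮ω₃ dl + |∮ω_r dl|)` on record far circles at times `≤ s₁`. -/
theorem circ_le_of_eddy_aux (hv : InDoorClass C v) (hsign : SignE3 v) {B : ℝ} (hB0 : 0 ≤ B)
    {R₀ : ℝ} (hR₀ : 0 ≤ R₀) {K₁ : ℝ} (hK₁0 : 0 ≤ K₁) (hK₁ : ∀ s < 0, ∀ x, ‖fderiv ℝ (v s) x‖ ≤ K₁ / (-s))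
    {s₀ s₁ : ℝ} (hs₀₁ : s₀ < s₁) (hs₁ : s₁ < 0)
    (hed : ∀ t : ℝ, t ≤ s₁ → ∀ r : ℝ, R₀ * Real.sqrt (-t) ≤ r → ∀ z : ℝ,
      (∀ s' : ℝ, s' ≤ t → ∀ z' : ℝ, circ v ((4 * (B + C) + R₀ + 1) * Real.sqrt (-s')) z' s' < circ v r z t) →
      remainder v r z t ≤ B / Real.sqrt (-t) * (vortCirc v r z t + |radVortCirc v r z t|)) :
    ∀ s ∈ Icc s₀ s₁, ∀ r : ℝ, 0 ≤ r → ∀ z : ℝ,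
      circ v r z s ≤ sSup {m : ℝ | ∃ s' : ℝ, s' ≤ s₁ ∧ ∃ z' : ℝ, m = circ v ((4 * (B + C) + R₀ + 1) * Real.sqrt (-s')) z' s'} +
        Real.pi * (4 * K₁ + 1) * r ^ 2 / (Real.sqrt (-s) * Real.sqrt (-s₀)) := by
  set R₁ : ℝ := 4 * (B + C) + R₀ + 1 with hR₁
  set A : ℝ := Real.pi * (4 * K₁ + 1) with hA
  set S : Set ℝ := {m : ℝ | ∃ s' : ℝ, s' ≤ s₁ ∧ ∃ z' : ℝ, m = circ v (R₁ * Real.sqrt (-s')) z' s'} with hS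
  set μ : ℝ := sSup S with hμ
  have hs₀ : s₀ < 0 := hs₀₁.trans hs₁
  have hsq₀ : 0 < Real.sqrt (-s₀) := Real.sqrt_pos.2 (neg_pos.2 hs₀)
  have hsq₁ : 0 < Real.sqrt (-s₁) := Real.sqrt_pos.2 (neg_pos.2 hs₁)
  have hC : 0 ≤ C := HalfSpaceWindowDoorCirculationCarryingRigidityConeFluxSubsolution.typeI_const_nonneg hv
  have hR₁pos : 0 < R₁ := by positivity
  have hApos : 0 < A := by positivity
  obtain ⟨hSbdd, hSle⟩ := tube_bddAbove hv hR₁pos.le hs₁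
  have hμ_ge : ∀ s' ≤ s₁, ∀ z', circ v (R₁ * Real.sqrt (-s')) z' s' ≤ μ := fun s' hs' z' =>
    le_csSup hSbdd ⟨s', hs', z', rfl⟩
  have hμ0 : 0 ≤ μ := by
    refine le_trans ?_ (hμ_ge s₁ le_rfl 0)
    exact circ_nonneg v (contDiff_one_slice hv hs₁) (signE3_atd hsign) hs₁ (by positivity) 0
  -- the smooth structure
  have hsm := isSmoothSpaceTimeOn_of_class hv.1 hv.2.1 hv.2.2.1 hv.2.2.2
  have hsmF := isSmoothSpaceTimeOn_circF hsm
  -- vorticity bound `ω₃ ≤ 4K₁/(−s)` and the quadratic bound at `s₀`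
  have hω3 : ∀ s < 0, ∀ x, curl (v s) x 2 ≤ (4 * K₁ + 1) / (-s) := fun s hs x => omega3_le_of_rate hK₁ hs x
  -- the comparison function `q`
  set F : ℝ → EuclideanSpace ℝ (Fin 3) → ℝ := fun t x => (2 * Real.pi)⁻¹ * circ v (cylRadius x) (x 2) t with hF
  set φ : ℝ → EuclideanSpace ℝ (Fin 3) → ℝ := fun t x =>
    (2 * Real.pi)⁻¹ * (μ + A * (Real.sqrt (-t) * Real.sqrt (-s₀))⁻¹ * (x 0 * x 0 + x 1 * x 1)) with hφ
  set q : ℝ → EuclideanSpace ℝ (Fin 3) → ℝ := fun t x => F t x - φ t x with hq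
  -- the sign multiplier `β = ∓B/√(−t)` absorbing `(B/√(−t))|Γ_z|`, and the drift: radial barrier drift + MEAN ADVECTION + `β e_z`
  set β : ℝ → EuclideanSpace ℝ (Fin 3) → ℝ := fun t x =>
    if 0 ≤ radVortCirc v (cylRadius x) (x 2) t then B / Real.sqrt (-t) else -(B / Real.sqrt (-t)) with hβ
  set b : ℝ → EuclideanSpace ℝ (Fin 3) → EuclideanSpace ℝ (Fin 3) := fun t x =>
    (2 / cylRadius x - B / Real.sqrt (-t) + meanR v (cylRadius x) (x 2) t) • Literature.Analysis.FluidPDE.eR x +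
      (meanZ v (cylRadius x) (x 2) t + β t x) • (eZ : EuclideanSpace ℝ (Fin 3)) with hb
  have h2π : 0 < 2 * Real.pi := by positivity
  have hproj : ∀ (i : Fin 3) (w : EuclideanSpace ℝ (Fin 3)), EuclideanSpace.proj (𝕜 := ℝ) i w = w i := fun i w => rfl
  have hci : ∀ i : Fin 3, ContDiff ℝ 2 fun y : EuclideanSpace ℝ (Fin 3) => y i := fun i =>
    (EuclideanSpace.proj (𝕜 := ℝ) i : EuclideanSpace ℝ (Fin 3) →L[ℝ] ℝ).contDiff
  have hQc : ContDiff ℝ 2 fun y : EuclideanSpace ℝ (Fin 3) => y 0 * y 0 + y 1 * y 1 :=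
    ((hci 0).mul (hci 0)).add ((hci 1).mul (hci 1))
  have hQsq : (fun y : EuclideanSpace ℝ (Fin 3) => y 0 * y 0 + y 1 * y 1) = fun y => y 0 ^ 2 + y 1 ^ 2 := by
    funext y; ring
  have hφ2 : ∀ t, ContDiff ℝ 2 (φ t) := fun t =>
    contDiff_const.mul (contDiff_const.add (contDiff_const.mul hQc))
  have hcontq : ContinuousOn (uncurry q) (Icc s₀ s₁ ×ˢ univ) := by
    have hFc : ContinuousOn (uncurry F) (Icc s₀ s₁ ×ˢ univ) :=
      hsmF.continuousOn.mono (prod_mono (fun t ht => lt_of_le_of_lt ht.2 hs₁) Subset.rfl)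
    have hφc : ContinuousOn (uncurry φ) (Icc s₀ s₁ ×ˢ univ) := by
      have hcont_yi : ∀ i : Fin 3, Continuous fun y : EuclideanSpace ℝ (Fin 3) => y i := fun i =>
        (continuous_apply i).comp (PiLp.continuous_ofLp 2 _)
      have hQ : Continuous fun p : ℝ × EuclideanSpace ℝ (Fin 3) => p.2 0 * p.2 0 + p.2 1 * p.2 1 :=
        (((hcont_yi 0).comp continuous_snd).mul ((hcont_yi 0).comp continuous_snd)).add
          (((hcont_yi 1).comp continuous_snd).mul ((hcont_yi 1).comp continuous_snd))
      have hinv : ContinuousOn (fun p : ℝ × EuclideanSpace ℝ (Fin 3) => (Real.sqrt (-p.1) * Real.sqrt (-s₀))⁻¹)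
          (Icc s₀ s₁ ×ˢ univ) := by
        refine ContinuousOn.inv₀ ?_ fun p hp => ?_
        · exact ((Real.continuous_sqrt.comp (continuous_neg.comp continuous_fst)).mul continuous_const).continuousOn
        · have ht : p.1 < 0 := lt_of_le_of_lt (mem_prod.1 hp).1.2 hs₁
          exact mul_ne_zero (Real.sqrt_pos.2 (neg_pos.2 ht)).ne' hsq₀.ne'
      exact continuousOn_const.mul (continuousOn_const.add ((continuousOn_const.mul hinv).mul hQ.continuousOn))
    exact hFc.sub hφc
  have hBup : ∀ t ∈ Icc s₀ s₁, ∀ x, q t x ≤ Real.pi * (C / Real.sqrt (-s₁)) ^ 2 * (-s₀) / (2 * A) :=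
    fun t ht x => barrier_upper_bound hv hμ0 hApos hs₀₁ hs₁ ht x
  have hinit : ∀ x, q s₀ x ≤ 0 := by
    intro x
    set ρ := cylRadius x with hρ
    have hρ0 : 0 ≤ ρ := cylRadius_nonneg x
    have hρ2 : ρ ^ 2 = x 0 * x 0 + x 1 * x 1 := by rw [cylRadius_sq x]; ring
    have hM : ∀ y, curl (v s₀) y 2 ≤ (4 * K₁ + 1) / (-s₀) := hω3 s₀ hs₀
    have h1 := circ_le_sq hv hs₀ hM hρ0 (x 2)
    have h2 : Real.pi * ρ ^ 2 * ((4 * K₁ + 1) / (-s₀)) = A * (Real.sqrt (-s₀) * Real.sqrt (-s₀))⁻¹ * (x 0 * x 0 + x 1 * x 1) := by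
      rw [Real.mul_self_sqrt (neg_pos.2 hs₀).le, ← hρ2, hA]; field_simp
    show (2 * Real.pi)⁻¹ * circ v ρ (x 2) s₀ -
        (2 * Real.pi)⁻¹ * (μ + A * (Real.sqrt (-s₀) * Real.sqrt (-s₀))⁻¹ * (x 0 * x 0 + x 1 * x 1)) ≤ 0
    rw [← mul_sub]
    refine mul_nonpos_of_nonneg_of_nonpos (by positivity) ?_
    have h3 := h1.trans_eq h2
    linarith
  have hsub : ∀ t ∈ Ioc s₀ s₁, ∀ x, 0 < q t x →
      ‖b t x‖ ≤ (2 / R₁ + B) / Real.sqrt (-s₁) + (C / Real.sqrt (-s₁) + (C / Real.sqrt (-s₁) + B / Real.sqrt (-s₁))) ∧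
      (∃ U : Set (EuclideanSpace ℝ (Fin 3)), IsOpen U ∧ x ∈ U ∧ ContDiffOn ℝ 2 (q t) U) ∧
      (∃ d : ℝ, HasDerivAt (fun τ => q τ x) d t ∧ d + fderiv ℝ (q t) x (b t x) - (Δ (q t)) x ≤ 0) := by
    intro t ht x hqpos
    have ht0 : t < 0 := lt_of_le_of_lt ht.2 hs₁
    have hsqt : 0 < Real.sqrt (-t) := Real.sqrt_pos.2 (neg_pos.2 ht0)
    have hv1 := contDiff_one_slice hv ht0
    set ρ := cylRadius x with hρ
    have hρ0 : 0 ≤ ρ := cylRadius_nonneg x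
    have hρ2 : ρ ^ 2 = x 0 * x 0 + x 1 * x 1 := by rw [cylRadius_sq x]; ring
    set κ : ℝ := A * (Real.sqrt (-t) * Real.sqrt (-s₀))⁻¹ with hκ
    have hκ0 : 0 ≤ κ := by positivity
    have hρR : R₁ * Real.sqrt (-t) < ρ := by
      by_contra hle
      push Not at hle
      have hmono := circ_mono v hv1 (signE3_atd hsign) ht0 hρ0 hle (x 2)
      have hμ' := hμ_ge t ht.2 (x 2)
      have hQ0 : 0 ≤ κ * (x 0 * x 0 + x 1 * x 1) := by rw [← hρ2]; positivity
      have : q t x ≤ 0 := by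
        show (2 * Real.pi)⁻¹ * circ v ρ (x 2) t -
            (2 * Real.pi)⁻¹ * (μ + A * (Real.sqrt (-t) * Real.sqrt (-s₀))⁻¹ * (x 0 * x 0 + x 1 * x 1)) ≤ 0
        rw [← mul_sub]
        refine mul_nonpos_of_nonneg_of_nonpos (by positivity) ?_
        have : A * (Real.sqrt (-t) * Real.sqrt (-s₀))⁻¹ * (x 0 * x 0 + x 1 * x 1) = κ * (x 0 * x 0 + x 1 * x 1) := by rw [hκ]
        linarith
      linarith
    have hρpos : 0 < ρ := lt_of_le_of_lt (by positivity) hρR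
    have hρne : cylRadius x ≠ 0 := hρpos.ne'
    have hρ4B : 4 * (B + C) * Real.sqrt (-t) ≤ ρ := by
      have : 4 * (B + C) * Real.sqrt (-t) ≤ R₁ * Real.sqrt (-t) := by rw [hR₁]; nlinarith [hsqt.le, hR₀]
      exact this.trans hρR.le
    have hmR := abs_meanR_le hv ht0 ρ (x 2)
    have hmZ := abs_meanZ_le hv ht0 ρ (x 2)
    have hβabs : |β t x| = B / Real.sqrt (-t) := by
      simp only [hβ]
      split_ifs
      · exact abs_of_nonneg (by positivity)
      · rw [abs_neg]; exact abs_of_nonneg (by positivity)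
    have hβmul : β t x * radVortCirc v ρ (x 2) t = B / Real.sqrt (-t) * |radVortCirc v ρ (x 2) t| := by
      simp only [hβ, hρ]
      split_ifs with hsg
      · rw [abs_of_nonneg hsg]
      · push Not at hsg
        rw [abs_of_neg hsg]; ring
    refine ⟨?_, ⟨univ, isOpen_univ, mem_univ _, ?_⟩, ?_⟩
    · have h1 := norm_radialDrift_le hB0 hR₁pos hs₁ ht.2 hρR
      have hst : Real.sqrt (-s₁) ≤ Real.sqrt (-t) := Real.sqrt_le_sqrt (by linarith [ht.2])
      have hCt : C / Real.sqrt (-t) ≤ C / Real.sqrt (-s₁) := div_le_div_of_nonneg_left hC hsq₁ hst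
      have hBt : B / Real.sqrt (-t) ≤ B / Real.sqrt (-s₁) := div_le_div_of_nonneg_left hB0 hsq₁ hst
      have hnR : ‖Literature.Analysis.FluidPDE.eR x‖ ≤ 1 := Literature.Analysis.FluidPDE.norm_eR_le_one x
      have hnZ : ‖(eZ : EuclideanSpace ℝ (Fin 3))‖ = 1 := by
        rw [EuclideanSpace.norm_eq]; simp [eZ]
      have e : b t x = (2 / cylRadius x - B / Real.sqrt (-t)) • Literature.Analysis.FluidPDE.eR x +
          (meanR v ρ (x 2) t • Literature.Analysis.FluidPDE.eR x + (meanZ v ρ (x 2) t + β t x) • (eZ : EuclideanSpace ℝ (Fin 3))) := by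
        simp only [hb, hρ, add_smul]; abel
      rw [e]
      refine (norm_add_le _ _).trans (add_le_add h1 ((norm_add_le _ _).trans (add_le_add ?_ ?_)))
      · rw [norm_smul, Real.norm_eq_abs]
        calc |meanR v ρ (x 2) t| * ‖Literature.Analysis.FluidPDE.eR x‖ ≤ C / Real.sqrt (-t) * 1 :=
              mul_le_mul hmR hnR (norm_nonneg _) (by positivity)
          _ ≤ C / Real.sqrt (-s₁) := by rw [mul_one]; exact hCt
      · rw [norm_smul, Real.norm_eq_abs, hnZ, mul_one]
        calc |meanZ v ρ (x 2) t + β t x| ≤ |meanZ v ρ (x 2) t| + |β t x| := abs_add_le _ _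
          _ ≤ C / Real.sqrt (-s₁) + B / Real.sqrt (-s₁) := by rw [hβabs]; exact add_le_add (hmZ.trans hCt) hBt
    · have hF2 : ContDiff ℝ 2 (F t) := contDiff_circF ((hsm.contDiff_slice ht0).of_le (by norm_cast))
      exact (hF2.sub (hφ2 t)).contDiffOn
    · have hF2 : ContDiff ℝ 2 (F t) := contDiff_circF ((hsm.contDiff_slice ht0).of_le (by norm_cast))
      have hFt := hasDerivAt_circF_time hsm ht0 x
      have hlaw := deriv_circ_s_eq_remainder hv.1 hv.2.1 hv.2.2.1 hv.2.2.2 ht0 hρpos (x 2)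
      set D : ℝ := -(-(1 / (2 * Real.sqrt (-t))) * Real.sqrt (-s₀)) / (Real.sqrt (-t) * Real.sqrt (-s₀)) ^ 2 with hDdef
      have hφt : HasDerivAt (fun τ => φ τ x) ((2 * Real.pi)⁻¹ * (A * D * (x 0 * x 0 + x 1 * x 1))) t :=
        ((((hasDerivAt_invSqrt_mul ht0 hs₀).const_mul A).mul_const (x 0 * x 0 + x 1 * x 1)).const_add μ).const_mul
          ((2 * Real.pi)⁻¹)
      have hAD : A * D = κ / (2 * (-t)) := by
        have htt : Real.sqrt (-t) ^ 2 = -t := Real.sq_sqrt (neg_pos.2 ht0).le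
        rw [hκ, hDdef]
        exact barrier_deriv_aux A _ _ _ hsqt hsq₀ htt
      have hQ := HalfSpaceWindowDoorCirculationCarryingRigidityConeFluxSubsolution.hasFDerivAt_horizSq x
      have hφ_has : HasFDerivAt (φ t)
          ((2 * Real.pi)⁻¹ • (κ • ((x 0 • EuclideanSpace.proj (𝕜 := ℝ) (0 : Fin 3) + x 0 • EuclideanSpace.proj (𝕜 := ℝ) (0 : Fin 3)) +
            (x 1 • EuclideanSpace.proj (𝕜 := ℝ) (1 : Fin 3) + x 1 • EuclideanSpace.proj (𝕜 := ℝ) (1 : Fin 3))))) x :=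
        ((hQ.const_mul κ).const_add μ).const_mul ((2 * Real.pi)⁻¹)
      have heR0 : (Literature.Analysis.FluidPDE.eR x) 0 = ρ⁻¹ * x 0 := by
        simp [Literature.Analysis.FluidPDE.eR, hρ]
      have heR1 : (Literature.Analysis.FluidPDE.eR x) 1 = ρ⁻¹ * x 1 := by
        simp [Literature.Analysis.FluidPDE.eR, hρ]
      set a : ℝ := 2 / ρ - B / Real.sqrt (-t) + meanR v ρ (x 2) t with ha
      set c : ℝ := meanZ v ρ (x 2) t + β t x with hc
      have hbdef : b t x = a • Literature.Analysis.FluidPDE.eR x + c • (eZ : EuclideanSpace ℝ (Fin 3)) := by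
        simp only [hb, ha, hc, hρ]
      have heZ0 : (eZ : EuclideanSpace ℝ (Fin 3)) 0 = 0 := by simp [eZ]
      have heZ1 : (eZ : EuclideanSpace ℝ (Fin 3)) 1 = 0 := by simp [eZ]
      have hb0 : (b t x) 0 = a * (ρ⁻¹ * x 0) := by
        rw [hbdef, PiLp.add_apply, PiLp.smul_apply, PiLp.smul_apply, smul_eq_mul, smul_eq_mul, heR0, heZ0, mul_zero, add_zero]
      have hb1 : (b t x) 1 = a * (ρ⁻¹ * x 1) := by
        rw [hbdef, PiLp.add_apply, PiLp.smul_apply, PiLp.smul_apply, smul_eq_mul, smul_eq_mul, heR1, heZ1, mul_zero, add_zero]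
      have hφ_fd : fderiv ℝ (φ t) x (b t x) = (2 * Real.pi)⁻¹ * (κ * (a * (2 * ρ))) := by
        rw [hφ_has.fderiv]
        simp only [smul_apply, add_apply, hproj, smul_eq_mul, hb0, hb1]
        have e : x 0 * (a * (ρ⁻¹ * x 0)) + x 0 * (a * (ρ⁻¹ * x 0)) +
            (x 1 * (a * (ρ⁻¹ * x 1)) + x 1 * (a * (ρ⁻¹ * x 1))) =
            a * (2 * (ρ⁻¹ * (x 0 * x 0 + x 1 * x 1))) := by ring
        rw [e, ← hρ2, pow_two, ← mul_assoc ρ⁻¹, inv_mul_cancel₀ hρne, one_mul]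
      have hφ_lap : (Δ (φ t)) x = (2 * Real.pi)⁻¹ * (κ * 4) := by
        have e : φ t = (fun _ : EuclideanSpace ℝ (Fin 3) => (2 * Real.pi)⁻¹ * μ) +
            ((2 * Real.pi)⁻¹ * κ) • (fun y : EuclideanSpace ℝ (Fin 3) => y 0 ^ 2 + y 1 ^ 2) := by
          funext y
          simp only [hφ, hκ, Pi.add_apply, Pi.smul_apply, smul_eq_mul]
          ring
        rw [e]
        have hc1 : ContDiffAt ℝ 2 (fun _ : EuclideanSpace ℝ (Fin 3) => (2 * Real.pi)⁻¹ * μ) x := contDiffAt_const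
        have hsq2 : ContDiffAt ℝ 2 (fun y : EuclideanSpace ℝ (Fin 3) => y 0 ^ 2 + y 1 ^ 2) x := by
          rw [← hQsq]; exact hQc.contDiffAt
        have hc2 : ContDiffAt ℝ 2 (((2 * Real.pi)⁻¹ * κ) • fun y : EuclideanSpace ℝ (Fin 3) => y 0 ^ 2 + y 1 ^ 2) x := by
          rw [Pi.smul_def]; exact hsq2.const_smul ((2 * Real.pi)⁻¹ * κ)
        rw [ContDiffAt.laplacian_add hc1 hc2, InnerProductSpace.laplacian_smul _ hsq2,
          Literature.Analysis.FluidPDE.laplacian_rho x]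
        simp [smul_eq_mul]
        ring
      have hFr := fderiv_circF_eR hsm ht0 x
      have hFz := fderiv_circF_eZ hsm ht0 hρne
      have hFΔ := laplacian_circF hsm ht0 hρne
      have hFb : fderiv ℝ (F t) x (b t x) = a * ((2 * Real.pi)⁻¹ * vortCirc v ρ (x 2) t) +
          c * (-((2 * Real.pi)⁻¹ * radVortCirc v ρ (x 2) t)) := by
        rw [hbdef, map_add, map_smul, map_smul, smul_eq_mul, smul_eq_mul]
        show a * fderiv ℝ (F t) x (Literature.Analysis.FluidPDE.eR x) + c * fderiv ℝ (F t) x eZ = _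
        rw [hFr, hFz]
      have hΔq : (Δ (q t)) x = (Δ (F t)) x - (Δ (φ t)) x :=
        ContDiffAt.laplacian_sub hF2.contDiffAt (hφ2 t).contDiffAt
      have hDq : fderiv ℝ (q t) x (b t x) = fderiv ℝ (F t) x (b t x) - fderiv ℝ (φ t) x (b t x) := by
        have e : q t = fun y => F t y - φ t y := rfl
        rw [e, fderiv_fun_sub ((hF2.differentiable (by norm_num)).differentiableAt) hφ_has.differentiableAt]
        rfl
      have hFΔ' : (Δ (F t)) x = (2 * Real.pi)⁻¹ * (deriv (fun r' => deriv (fun r'' => circ v r'' (x 2) t) r') ρ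
          + ρ⁻¹ * deriv (fun r' => circ v r' (x 2) t) ρ
          + deriv (fun z' => deriv (fun z'' => circ v ρ z'' t) z') (x 2)) := hFΔ
      rw [← hρ] at hFt
      refine ⟨_, hFt.sub hφt, ?_⟩
      have hρR₀ : R₀ * Real.sqrt (-t) ≤ ρ := by
        have : R₀ * Real.sqrt (-t) ≤ R₁ * Real.sqrt (-t) := by rw [hR₁]; nlinarith [hsqt.le]
        exact this.trans hρR.le
      have hΓμ : μ < circ v ρ (x 2) t := by
        have e : q t x = (2 * Real.pi)⁻¹ * (circ v ρ (x 2) t - (μ + κ * (x 0 * x 0 + x 1 * x 1))) := by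
          show (2 * Real.pi)⁻¹ * circ v ρ (x 2) t -
              (2 * Real.pi)⁻¹ * (μ + A * (Real.sqrt (-t) * Real.sqrt (-s₀))⁻¹ * (x 0 * x 0 + x 1 * x 1)) = _
          rw [hκ]; ring
        have hq' : 0 < (2 * Real.pi)⁻¹ * (circ v ρ (x 2) t - (μ + κ * (x 0 * x 0 + x 1 * x 1))) := by rw [← e]; exact hqpos
        have hQ0 : 0 ≤ κ * (x 0 * x 0 + x 1 * x 1) := by rw [← hρ2]; positivity
        have := (mul_pos_iff_of_pos_left (by positivity : (0:ℝ) < (2 * Real.pi)⁻¹)).1 hq'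
        linarith
      have hStep1 := hed t ht.2 ρ hρR₀ (x 2) fun s' hs' z' => lt_of_le_of_lt (hμ_ge s' (hs'.trans ht.2) z') hΓμ
      have hΓr0 : 0 ≤ vortCirc v ρ (x 2) t := vortCirc_nonneg v (signE3_atd hsign) ht0 hρ0 _
      have hΓr' : deriv (fun r' => circ v r' (x 2) t) ρ = vortCirc v ρ (x 2) t := deriv_circ_eq_vortCirc v hv1 ρ (x 2)
      rw [hDq, hΔq, hFb, hφ_fd, hφ_lap, hFΔ', hlaw, hΓr']
      set Γr := vortCirc v ρ (x 2) t with hΓr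
      set ϱ := radVortCirc v ρ (x 2) t with hϱ
      set Γrr := deriv (fun r' => deriv (fun r'' => circ v r'' (x 2) t) r') ρ
      set Γzz := deriv (fun z' => deriv (fun z'' => circ v ρ z'' t) z') (x 2)
      set Rm := remainder v ρ (x 2) t with hRm
      set mR := meanR v ρ (x 2) t with hmRdef
      set mZ := meanZ v ρ (x 2) t with hmZdef
      -- the barrier beats the radial inward speed `(B + C)/√(−t)` outside the tube `r ≥ 4(B+C)√(−t)`
      have hbar : 0 ≤ (2 * Real.pi)⁻¹ * (A * D * (x 0 * x 0 + x 1 * x 1))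
          + (2 * Real.pi)⁻¹ * (κ * ((2 / ρ - (B + C) / Real.sqrt (-t)) * (2 * ρ))) - (2 * Real.pi)⁻¹ * (κ * 4) := by
        rw [← hρ2, show A * D * ρ ^ 2 = (A * D) * ρ ^ 2 by ring, hAD]
        have htt : Real.sqrt (-t) ^ 2 = -t := Real.sq_sqrt (neg_pos.2 ht0).le
        set σ : ℝ := Real.sqrt (-t) with hσ
        have e0 : (2 / ρ - (B + C) / σ) * (2 * ρ) = 4 - 2 * (B + C) * ρ / σ := by
          field_simp
          ring
        rw [e0, ← htt]
        have e1 : (2 * Real.pi)⁻¹ * (κ / (2 * σ ^ 2) * ρ ^ 2) + (2 * Real.pi)⁻¹ * (κ * (4 - 2 * (B + C) * ρ / σ))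
            - (2 * Real.pi)⁻¹ * (κ * 4) = (2 * Real.pi)⁻¹ * κ * (ρ / σ) * ((ρ - 4 * (B + C) * σ) / (2 * σ)) := by
          field_simp
          ring
        rw [e1]
        have h4 : 0 ≤ (ρ - 4 * (B + C) * σ) / (2 * σ) := div_nonneg (by linarith) (by positivity)
        have : 0 ≤ ρ / σ := by positivity
        exact mul_nonneg (mul_nonneg (mul_nonneg (by positivity) hκ0) this) h4
      -- the mean radial advection acting on the barrier: `v̄_r φ_r ≥ −(C/√(−t)) φ_r`
      have hmean_bar : (2 * Real.pi)⁻¹ * (κ * ((2 / ρ - (B + C) / Real.sqrt (-t)) * (2 * ρ))) ≤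
          (2 * Real.pi)⁻¹ * (κ * (a * (2 * ρ))) := by
        have hale : 2 / ρ - (B + C) / Real.sqrt (-t) ≤ a := by
          rw [ha]
          have := (abs_le.1 hmR).1
          have e : (B + C) / Real.sqrt (-t) = B / Real.sqrt (-t) + C / Real.sqrt (-t) := by rw [add_div]
          linarith
        have h2ρ : (0 : ℝ) ≤ 2 * ρ := by positivity
        exact mul_le_mul_of_nonneg_left (mul_le_mul_of_nonneg_left (mul_le_mul_of_nonneg_right hale h2ρ) hκ0) (by positivity)
      -- the eddy hypothesis and the multiplier `β`
      have hT : Rm ≤ B / Real.sqrt (-t) * (Γr + |ϱ|) := hStep1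
      have hβϱ : β t x * ϱ = B / Real.sqrt (-t) * |ϱ| := hβmul
      have hcϱ : c * ϱ = mZ * ϱ + B / Real.sqrt (-t) * |ϱ| := by rw [hc, add_mul, hβϱ]
      have key : (2 * Real.pi)⁻¹ * (Γrr - ρ⁻¹ * Γr + Γzz + Rm - mR * Γr + mZ * ϱ) - (2 * Real.pi)⁻¹ * (A * D * (x 0 * x 0 + x 1 * x 1)) +
          (a * ((2 * Real.pi)⁻¹ * Γr) + c * (-((2 * Real.pi)⁻¹ * ϱ)) - (2 * Real.pi)⁻¹ * (κ * (a * (2 * ρ)))) -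
          ((2 * Real.pi)⁻¹ * (Γrr + ρ⁻¹ * Γr + Γzz) - (2 * Real.pi)⁻¹ * (κ * 4)) =
          (2 * Real.pi)⁻¹ * (Rm - B / Real.sqrt (-t) * (Γr + |ϱ|)) -
          ((2 * Real.pi)⁻¹ * (A * D * (x 0 * x 0 + x 1 * x 1))
            + (2 * Real.pi)⁻¹ * (κ * (a * (2 * ρ))) - (2 * Real.pi)⁻¹ * (κ * 4)) := by
        rw [show c * (-((2 * Real.pi)⁻¹ * ϱ)) = -((2 * Real.pi)⁻¹ * (c * ϱ)) by ring, hcϱ, ha]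
        field_simp
        ring
      rw [key]
      have h1 : (2 * Real.pi)⁻¹ * (Rm - B / Real.sqrt (-t) * (Γr + |ϱ|)) ≤ 0 :=
        mul_nonpos_of_nonneg_of_nonpos (by positivity) (by linarith)
      linarith
  have hmp := le_of_subsolution (m := 0)
    (by positivity : (0:ℝ) ≤ (2 / R₁ + B) / Real.sqrt (-s₁) + (C / Real.sqrt (-s₁) + (C / Real.sqrt (-s₁) + B / Real.sqrt (-s₁))))
    hcontq hBup hinit hsub
  intro s hs r hr z
  have hs0 : s < 0 := lt_of_le_of_lt hs.2 hs₁
  have hsqs : 0 < Real.sqrt (-s) := Real.sqrt_pos.2 (neg_pos.2 hs0)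
  have hx := hmp s hs (cylPt r 0 z)
  have hrad : cylRadius (cylPt r 0 z) = r := by
    rw [cylRadius]
    simp [cylPt, Real.sqrt_sq hr]
  have hz : (cylPt r 0 z) 2 = z := by simp [cylPt]
  have h0 : (cylPt r 0 z) 0 * (cylPt r 0 z) 0 + (cylPt r 0 z) 1 * (cylPt r 0 z) 1 = r ^ 2 := by simp [cylPt]; ring
  have hq' : (2 * Real.pi)⁻¹ * circ v r z s -
      (2 * Real.pi)⁻¹ * (μ + A * (Real.sqrt (-s) * Real.sqrt (-s₀))⁻¹ * r ^ 2) ≤ 0 := by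
    change (2 * Real.pi)⁻¹ * circ v (cylRadius (cylPt r 0 z)) ((cylPt r 0 z) 2) s -
      (2 * Real.pi)⁻¹ * (μ + A * (Real.sqrt (-s) * Real.sqrt (-s₀))⁻¹ *
        ((cylPt r 0 z) 0 * (cylPt r 0 z) 0 + (cylPt r 0 z) 1 * (cylPt r 0 z) 1)) ≤ 0 at hx
    rw [hrad, hz, h0] at hx
    exact hx
  rw [← mul_sub] at hq'
  rcases mul_nonpos_iff.1 hq' with ⟨-, h2⟩ | ⟨h1, -⟩
  · have e : A * (Real.sqrt (-s) * Real.sqrt (-s₀))⁻¹ * r ^ 2 =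
        Real.pi * (4 * K₁ + 1) * r ^ 2 / (Real.sqrt (-s) * Real.sqrt (-s₀)) := by
      rw [hA]; field_simp
    linarith
  · exact absurd h1 (not_le.2 (by positivity))

end Summit.NavierStokesRegularity.NavierStokesRegularity.Theorems.HalfSpaceWindowDoorCirculationCarryingRigidityEddyBarrier

end
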